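import Literature.IUT.HodgeTheaters.BaseHodgeTheaters
import HarnessLib

/-!
# Proofs for base-ΘNF-Hodge theaters, III: Proposition 4.7 (iii), last sentence ([IUTchI] p. 113), and the
# non-vacuity of Definition 4.6 — abc-iut cell, layer L5 (discharge of `BaseHodgeTheaters.lean`)

Mochizuki, *Inter-universal Teichmüller theory I*, §4 (kurims May-2020 manuscript), Proposition 4.7 (iii), last
sentence: "when considered up to composition with multiplication by an element of `F_l^⋇`, the bijection `†ζ_⋆` is
independent of the choice of `†φ^NF_⋆` within the `F_l^⋇`-orbit of `†φ^NF_⋆` relative to the natural poly-action of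
`F_l^⋇` on `†𝒟^⊚`". The named statement `Prop47iii_orbit` of `BaseHodgeTheaters.lean` (sharp form: the distinguished
class for the post-composite of `†φ^NF_⋆` with the poly-action of `g` is `g⁻¹ · [†ε]`) is PROVED, from ONE constituent
of `†φ^NF_1` at ONE place: post-composition with an automorphism of label `g` pulls global classes back through
translation by `g` (Ex. 4.5 (i)), and pull-back along a constituent is injective on `LabCusp(†𝒟^⊚)`.
Also: Definition 4.6 (i)–(iii) is NON-VACUOUS over every `BaseThetaDatum` — the model data of Examples 4.3 (iv) and
4.4 (iv) form a `𝒟`-ΘNF-Hodge theater (`nonempty_dThetaNFHodgeTheater`, `nonempty_dNFBridge`, `nonempty_dThetaBridge`).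
Proof-only companion (no new definitions); record-only, [claim: Mochizuki2012, status: disputed]; nothing here takes a side.
-/

namespace Literature.IUT.HodgeTheaters

open CategoryTheory

universe u

namespace BaseThetaDatum

variable {𝔡 : BaseThetaDatum.{u}}

/-- **Proposition 4.7 (iii), last sentence, holds** ([IUTchI] p. 113): if `e = [†ε]` is the distinguished class for
`†φ^NF_⋆` (pull-backs along `†φ^NF_j` have label `†χ(j)`) and `e'` the one for the post-composite of `†φ^NF_⋆` with
the poly-action of `g ∈ F_l^⋇` on `†𝒟^⊚`, then `e' = g⁻¹ · e` — so `†ζ_⋆` changes by multiplication by an element of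
`F_l^⋇`. [claim: Mochizuki2012, status: disputed] -/
theorem prop47iii_orbit_holds (H : 𝔡.DThetaNFHodgeTheater) : Prop47iii_orbit H := by
  intro g e e' he he'
  obtain ⟨ι, κ, δ, γ, hNF, -⟩ := H.isModel
  obtain ⟨v, -⟩ := 𝔡.exists_isBad
  obtain ⟨f₀, hf₀⟩ : ∃ f₀, f₀ ∈ H.polyNF (ι 1) v := by
    rw [hNF]
    exact ⟨_, _, (mem_phiNFj_iff _).2 ⟨Iso.refl _, Iso.refl _, autLabel_refl _, rfl⟩, rfl⟩
  obtain ⟨c, hc⟩ := polyAct_nonempty H.glob g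
  have hc' : autLabel c = g := hc
  have h1 := he (ι 1) v f₀ hf₀
  have h2 := he' (ι 1) v (𝔡.postNF f₀ c) ⟨f₀, hf₀, c, hc, rfl⟩
  rw [𝔡.labPull_postNF, labIsoG_symm_eq_autLabel_smul, hc', ← h1] at h2
  have h3 := (𝔡.labPull f₀).injective (((𝔡.isTorsor_labCusp v _).labelEquiv _).injective h2)
  rw [← h3, smul_smul, inv_mul_cancel, one_smul]

/-! ### Definition 4.6 is non-vacuous: the model Hodge theater -/

/-- Transport of a poly-morphism `𝒟_v → 𝒟^⊚` along identity isomorphisms is the identity.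
[claim: Mochizuki2012, status: disputed] -/
theorem PolyHomNF.conj_refl {v : 𝔡.V} (P : PolyHomNF v (𝔡.D v) 𝔡.DG) :
    PolyHomNF.conj 𝔡 (Iso.refl _) (Iso.refl _) P = P := by
  ext f
  constructor
  · rintro ⟨f₀, hf₀, rfl⟩
    rwa [Iso.refl_symm, 𝔡.preNF_refl, 𝔡.postNF_refl]
  · intro hf
    exact ⟨f, hf, by rw [Iso.refl_symm, 𝔡.preNF_refl, 𝔡.postNF_refl]⟩

/-- **Definition 4.6 (iii) is non-vacuous** over every `BaseThetaDatum`: the model data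
`𝒟^⊚ ⟵^{φ^NF_⋆} 𝒟_⋆ ⟶^{φ^Θ_⋆} 𝒟_>` of Examples 4.3 (iv), 4.4 (iv) form a `𝒟`-ΘNF-Hodge theater (exhibited by identity
isomorphisms). [claim: Mochizuki2012, status: disputed] -/
theorem nonempty_dThetaNFHodgeTheater (𝔡 : BaseThetaDatum.{u}) : Nonempty 𝔡.DThetaNFHodgeTheater :=
  ⟨{ J := FlStar 𝔡.l
     capsule := 𝔡.modelCapsule
     glob := 𝔡.DG
     cod := 𝔡.tautStrip
     polyNF := 𝔡.modelNFBridge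
     polyΘ := 𝔡.modelThetaBridge
     isModel := ⟨Equiv.refl _, fun _ => Iso.refl _, Iso.refl _, Iso.refl _, fun j v => by
        rw [Pi.isoApp_refl]; exact (PolyHomNF.conj_refl _).symm, fun j v => by
        ext g; simp [Pi.isoApp_refl]⟩ }⟩

/-- **Definition 4.6 (i) is non-vacuous**: `𝒟`-NF-bridges exist over every `BaseThetaDatum`.
[claim: Mochizuki2012, status: disputed] -/
theorem nonempty_dNFBridge (𝔡 : BaseThetaDatum.{u}) : Nonempty 𝔡.DNFBridge :=
  ⟨(nonempty_dThetaNFHodgeTheater 𝔡).some.toDNFBridge⟩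

/-- **Definition 4.6 (ii) is non-vacuous**: `𝒟`-Θ-bridges exist over every `BaseThetaDatum`.
[claim: Mochizuki2012, status: disputed] -/
theorem nonempty_dThetaBridge (𝔡 : BaseThetaDatum.{u}) : Nonempty 𝔡.DThetaBridge :=
  ⟨(nonempty_dThetaNFHodgeTheater 𝔡).some.toDThetaBridge⟩

end BaseThetaDatum

end Literature.IUT.HodgeTheaters
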